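import Summits.BirchSwinnertonDyer.BirchSwinnertonDyer.Theorems.GenusKolyvaginAtTwoGenusPrimitiveSupplyAtTwoTwinConverse
import Literature.NumberTheory.QuadraticFields.ImaginaryQuadraticPrescribedSplitting
import Literature.NumberTheory.EllipticCurves.TwistFamilySelmerGroupCardInvarianceProofs
import Literature.NumberTheory.EllipticCurves.QuadraticTwistJInvariantProofs
import Literature.NumberTheory.EllipticCurves.GlobalMinimalModelProofs
import Literature.NumberTheory.EllipticCurves.BSDRankZeroDensity

/-!
# Route `GenusKolyvaginAtTwo`, crux `GenusPrimitiveSupplyAtTwo` (stmt-BirchSwinnertonDyer-22136), line `genus-supply`: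
# stub A's supply hypothesis (SUPPLY) from Mazur–Rubin prime twisting

Prover seat bsd-line-gk2-p5 (g0, 2026-08-28), cell `bsd-f1-sign2`; helper for the registered stub `stub_minimalTwinSupplyAtTwo`
(stub A) of line `genus-supply` (skeleton `Cruxes/GenusPrimitiveSupplyAtTwo/Lines/genus_supply.lean`, LEAD bsd-line-gk2-p1).

The LEAD's file `GenusKolyvaginAtTwoGenusPrimitiveSupplyAtTwoTwinConverse.lean` proves stub A from Modularity, the `2`-parity
theorem, the rank-one `2`-converse (CONV₂, OPEN crux 19220) and a hypothesis (SUPPLY) left in binders: «for `E` non-CM with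
`r_an(E) = 0` and `ρ_{E,2^n}` onto, SOME Kolyvagin-(H2)-admissible Heegner field `K` (odd `d_K ≠ −3`, every `q ∣ N_E`
split, `d_K·(−|Δ|)`, `d_K·(−2|Δ|)` non-squares) has a globally minimal `Wd ≅ E^{(d_K)}` with `#Sel₂(Wd) = 2`». THIS FILE
DERIVES (SUPPLY) from PRINT (`minimalSelmerTwinSupply_of_lowering`), namely from

* (MR) the Mazur–Rubin LOWERING STEP over `ℚ` — B. Mazur, K. Rubin, *Ranks of twists of elliptic curves and Hilbert's
  tenth problem*, Invent. Math. 181 (2010), Prop. 5.2 in the form its proof gives: «`E(ℚ)[2] = 0` and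
  `d₂(E) := dim_{𝔽₂} Sel₂(E/ℚ) > 1` ⟹ `d₂(E^{(p)}) = d₂(E) − 2` for a prime `p` chosen by Čebotarev with Frobenius `γ`,
  `γ` trivial on `M·ℚ^{ab}` (Lemma 3.6), so `p ≡ 1` modulo ANY prescribed modulus `m`» — kept here as the hypothesis
  `hMR` spelled out in binders (its Literature typing is filed separately);
* Modularity `exists_isNewformOf` (BCDT 2001) and the `2`-parity theorem `p_parity · 2` (Dokchitser–Dokchitser 2010 ∕
  Monsky 1996) — already inputs of the LEAD's reduction — and the Cassels–Tate pairing `exists_casselsTate_pairing`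
  (Cassels 1962; tree parity count `exists_selmerRank_eq_add`: `dim Sel₂ = dim E(ℚ)[2] + corank + 2m`);
* tree THEOREMS: Dirichlet + the decomposition law (`Quadratic.exists_prime_and_field_discr_eq_neg`,
  `ncard_primesOver_two_eq_two_iff`, `ncard_primesOver_eq_two_iff_legendreSym`), quadratic fields of prescribed
  fundamental discriminant (`exists_numberField_discr_eq`), the descent count and its model invariance
  (`natCard_selmerGroup_smul`), global minimal models over `ℚ` (`hasGlobalMinimalModel_rat_holds`).

THE ARGUMENT. Take a prime `q₀ ≡ 7 (mod 8)`, `q₀ ≡ −1 (mod q)` for every `q ∣ N_E`, `q₀ > |Δ_E|` (Dirichlet). Then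
`K₀ = ℚ(√−q₀)` is a Heegner field for `N_E`, so a minimal model `W₀` of `E^{(−q₀)}` has root number `−1` (Modularity,
LEAD's `rootNumber_twin_eq_neg_one`), odd `corank_{ℤ₂} Sel_{2^∞}` (`2`-parity), trivial rational `2`-torsion (`ρ̄_{E,2}`
onto), hence ODD `d₂(W₀) = 2k + 1` (Cassels–Tate). Apply (MR) `k` times with modulus `m = 8·q₀·N_E` (times the primes
already used): the twisting primes `p_i ≡ 1 (mod m)` are distinct, prime to `q₀`, and `u = ∏ p_i ≡ 1 (mod m)` is
square-free; a minimal model `Wd` of `E^{(−q₀ u)}` has `d₂ = 1`, i.e. `#Sel₂(Wd) = 2`. Finally `d = −q₀ u ≡ 1 (mod 8)`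
is a negative odd fundamental discriminant `≤ −7`, `K = ℚ(√d)` is imaginary quadratic with `d_K = d`, every `q ∣ N_E`
splits in `K` (`d ≡ 1 (mod 8)`; `d ≡ (−q₀)·u ≡ 1 (mod q)` for odd `q ∣ N_E`), and `ord_{q₀}(d·|Δ|) =
ord_{q₀}(2d·|Δ|) = 1` is odd, so Kolyvagin's two (H2) non-square conditions hold. The walk never leaves the Heegner
local class because every twisting prime is `≡ 1` at `2`, at `q₀` and at every `q ∣ N_E` — this is the observation
that Mazur–Rubin prime twisting (route thesis: «Mazur–Rubin Prop. 3.3: Kolyvagin primes … move the 2-Selmer rank»)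
supplies the `2`-Selmer-minimal twin INSIDE Kolyvagin's (H2)-admissible Heegner fields, for EVERY sign of `Δ_E` (the
route's worry «for `Δ_E > 0` Kolyvagin primes act trivially on `E[2]`» concerns `±1` steps; the `−2` steps of Prop. 5.2
use primes with `Frob_p = 1` on `E[2]` and need no hypothesis on `Δ_E`).

CONSEQUENCE (`stub_minimalTwinSupplyAtTwo_of_lowering_of_twoConverse`): stub A holds VERBATIM modulo {(MR), Modularity,
`2`-parity, Cassels–Tate} — all PRINT — and (CONV₂), the rank-one `2`-converse (OPEN, crux 19220 of route
`TwoAdicConverse`). So the only non-print input of stub A is the `2`-converse; the «twin supply» half of crux 22136 is not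
an independent open problem. Hypotheses `¬CM` and surjectivity beyond level `2` are idle in (SUPPLY).
presearch: (MR) → [corpus: paper:anon2010-ranks-twists-elliptic-curves-hilberts-tenth-problem, Prop. 5.2 proof (preprint
p. 14) + Lemma 3.6 (p. 10)] gives it for every number field `K` (here `K = ℚ`); `lit search --hybrid`, `lit vsearch`,
`lit galaxy search --star all` («2-Selmer rank|Selmer ranks of quadratic twists»): no other formal source needed, galaxy noise.
No summit and no leaf is proved by this file; BSD is not proved by any of this.
-/

set_option linter.dupNamespace false -- tree convention: `Summit.BirchSwinnertonDyer.BirchSwinnertonDyer.Theorems` (summit = sub-problem)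

noncomputable section

open scoped AddSubgroup

namespace Summit.BirchSwinnertonDyer.BirchSwinnertonDyer.Theorems.GenusKoly

open NumberField WeierstrassCurve Literature.NumberTheory.EllipticCurves
  Literature.NumberTheory.EllipticCurves.ModularForms Literature.NumberTheory.QuadraticFields

/-! ## §1 Elementary helpers -/

/-- A nonzero rational with ODD `q`-adic valuation at some prime `q` is not a square in `ℚ`. [folklore] -/
theorem not_isSquare_of_odd_padicValRat {q : ℕ} [hq : Fact q.Prime] {x : ℚ} (hx : x ≠ 0)
    (hodd : Odd (padicValRat q x)) : ¬ IsSquare x := by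
  rintro ⟨y, rfl⟩
  have hy : y ≠ 0 := fun h ↦ hx (by rw [h, mul_zero])
  rw [padicValRat.mul hy hy, ← two_mul] at hodd
  exact (Int.not_odd_iff_even.mpr (even_two_mul _)) hodd

/-- A globally minimal model of the twist of a model: for `V ≅ W^{(d)}` and `e ≠ 0` there is a globally minimal `V₁`
with `V₁ ≅ W^{(d e)}` and `#Sel₂(V₁) = #Sel₂(V^{(e)})` (`quadraticTwist_smul`, `quadraticTwist_quadraticTwist`,
`hasGlobalMinimalModel_rat_holds`, `natCard_selmerGroup_smul`). [cite: SilvermanAEC2009, VIII.8 Cor. 8.3 and X.5 Cor. 5.4] -/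
theorem exists_globallyMinimal_twist_of_twist (W : WeierstrassCurve ℚ) [W.IsElliptic] (d : ℚ)
    (V : WeierstrassCurve ℚ) [V.IsElliptic] (hV : ∃ C : VariableChange ℚ, C • W.quadraticTwist d = V)
    {e : ℚ} (he : e ≠ 0) :
    ∃ (V₁ : WeierstrassCurve ℚ) (_ : V₁.IsElliptic) (_ : V₁.IsGloballyMinimal),
      (∃ C : VariableChange ℚ, C • W.quadraticTwist (d * e) = V₁) ∧
      Nat.card (V₁.selmerGroup 2) = Nat.card ((V.quadraticTwist e).selmerGroup 2) := by
  haveI := V.isElliptic_quadraticTwist he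
  obtain ⟨C, rfl⟩ := hV
  obtain ⟨C₁, hC₁⟩ := hasGlobalMinimalModel_rat_holds ((C • W.quadraticTwist d).quadraticTwist e)
  refine ⟨C₁ • (C • W.quadraticTwist d).quadraticTwist e, inferInstance, hC₁, ?_, ?_⟩
  · refine ⟨C₁ * ⟨C.u, e * C.r, 0, 0⟩, ?_⟩
    rw [mul_smul, ← W.quadraticTwist_quadraticTwist d e, quadraticTwist_smul]
  · exact natCard_selmerGroup_smul _ C₁ two_ne_zero

/-! ## §2 The Mazur–Rubin walk: lowering `d₂` by `2` inside a prescribed congruence class -/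

/-- **The walk.** Granted the Mazur–Rubin lowering step (hypothesis `hMR`, = Mazur–Rubin 2010 Prop. 5.2 over `ℚ` in its
proof form: `V(ℚ)[2] = 0`, `#Sel₂(V) = 2^s`, `s > 1` ⟹ for every modulus `m ≠ 0` a prime `p ≡ 1 (mod m)` with
`#Sel₂(V^{(p)}) = 2^{s-2}`): if `ρ̄_{W,2}` is onto (so every twist of `W` has trivial rational `2`-torsion) and `V ≅ W^{(d)}`
is globally minimal with `#Sel₂(V) = 2^{2k+1}`, then for every `m ≠ 0` there is a square-free `u ≡ 1 (mod m)` and a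
globally minimal `V' ≅ W^{(d u)}` with `#Sel₂(V') = 2`. Induction on `k`. [cite: MazurRubin2010, Prop. 5.2 (proof) and Thm. 1.7 (proof)] -/
theorem exists_twist_card_selmerGroup_two_of_lowering
    (hMR : ∀ (V : WeierstrassCurve ℚ) [V.IsElliptic], Nat.card (V.toAffine.Point[((2 : ℕ) : ℤ)]) = 1 →
      ∀ s : ℕ, Nat.card (V.selmerGroup 2) = 2 ^ s → 1 < s → ∀ m : ℕ, m ≠ 0 →
        ∃ p : ℕ, p.Prime ∧ (p : ℤ) ≡ 1 [ZMOD (m : ℤ)] ∧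
          Nat.card ((V.quadraticTwist (p : ℚ)).selmerGroup 2) = 2 ^ (s - 2))
    (W : WeierstrassCurve ℚ) [W.IsElliptic] (hsurj : W.HasSurjectiveModNGaloisRep ((2 : ℤ) ^ 1)) (k : ℕ) :
    ∀ {d : ℚ}, d ≠ 0 → ∀ (V : WeierstrassCurve ℚ) [V.IsElliptic] [V.IsGloballyMinimal],
      (∃ C : VariableChange ℚ, C • W.quadraticTwist d = V) → Nat.card (V.selmerGroup 2) = 2 ^ (2 * k + 1) →
      ∀ m : ℕ, m ≠ 0 →
        ∃ u : ℕ, Squarefree u ∧ (u : ℤ) ≡ 1 [ZMOD (m : ℤ)] ∧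
          ∃ (V' : WeierstrassCurve ℚ) (_ : V'.IsElliptic) (_ : V'.IsGloballyMinimal),
            (∃ C : VariableChange ℚ, C • W.quadraticTwist (d * u) = V') ∧ Nat.card (V'.selmerGroup 2) = 2 := by
  induction k with
  | zero =>
    intro d hd V _ _ hV hSel m hm
    refine ⟨1, squarefree_one, Int.ModEq.refl _, V, inferInstance, inferInstance, ?_, by simpa using hSel⟩
    simpa using hV
  | succ k ih =>
    intro d hd V _ _ hV hSel m hm
    have htors : Nat.card (V.toAffine.Point[((2 : ℕ) : ℤ)]) = 1 := natCard_twoTorsion_twin_eq_one W hsurj hd V hV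
    obtain ⟨p, hp, hpm, hSelp⟩ := hMR V htors (2 * (k + 1) + 1) hSel (by omega) m hm
    have hp0 : (p : ℚ) ≠ 0 := by exact_mod_cast hp.ne_zero
    obtain ⟨V₁, _, _, hV₁, hSel₁⟩ := exists_globallyMinimal_twist_of_twist W d V hV hp0
    have hk : 2 * (k + 1) + 1 - 2 = 2 * k + 1 := by omega
    have hSel₁' : Nat.card (V₁.selmerGroup 2) = 2 ^ (2 * k + 1) := by rw [hSel₁, hSelp, hk]
    have hmp : m * p ≠ 0 := mul_ne_zero hm hp.ne_zero
    obtain ⟨u₁, hu₁, hu₁m, V', _, _, hV', hSel'⟩ :=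
      ih (mul_ne_zero hd hp0) V₁ hV₁ hSel₁' (m * p) hmp
    -- `u₁ ≡ 1 (mod m)` and `u₁ ≡ 1 (mod p)`
    have hu₁m' : (u₁ : ℤ) ≡ 1 [ZMOD (m : ℤ)] :=
      hu₁m.of_dvd (by exact_mod_cast Dvd.intro p rfl)
    have hu₁p : (u₁ : ℤ) ≡ 1 [ZMOD (p : ℤ)] :=
      hu₁m.of_dvd (by exact_mod_cast Dvd.intro_left m rfl)
    have hpu : ¬ p ∣ u₁ := fun h ↦ by
      have hdu : (p : ℤ) ∣ (u₁ : ℤ) := by exact_mod_cast h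
      have h1 : (p : ℤ) ∣ 1 := by simpa using Int.dvd_sub hdu (Int.ModEq.dvd hu₁p.symm)
      exact hp.one_lt.ne' (by exact_mod_cast Int.eq_one_of_dvd_one (by positivity) h1)
    refine ⟨p * u₁, ?_, ?_, V', inferInstance, inferInstance, ?_, hSel'⟩
    · exact (Nat.squarefree_mul (hp.coprime_iff_not_dvd.mpr hpu)).mpr ⟨hp.squarefree, hu₁⟩
    · have := hpm.mul hu₁m'
      simpa using this
    · simpa [mul_assoc] using hV'

/-! ## §3 Quadratic fields with prescribed discriminant: the Heegner hypothesis from congruences -/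

/-- **Heegner hypothesis from congruences.** If `[K : ℚ] = 2`, `d_K = D` with `D ≡ 1 (mod 8)` and `D ≡ 1 (mod p)` for every
odd prime `p ∣ N`, then every prime factor of `N` splits in `K` (decomposition law in quadratic fields: `2` splits iff
`d_K ≡ 1 (mod 8)`, an odd `p` splits iff `(d_K / p) = 1`; tree `ncard_primesOver_two_eq_two_iff`,
`ncard_primesOver_eq_two_iff_legendreSym`). [cite: GrossLMS1991, §1 (p. 235)] -/
theorem satisfiesHeegnerHypothesis_of_discr_congr {K : Type} [Field K] [NumberField K] (h2 : Module.finrank ℚ K = 2)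
    (N : ℕ) {D : ℤ} (hdisc : NumberField.discr K = D) (hD8 : D % 8 = 1)
    (hres : ∀ p : ℕ, p.Prime → p ∣ N → p ≠ 2 → (D : ZMod p) = 1) : SatisfiesHeegnerHypothesis N K := by
  intro p hp hpN
  by_cases hp2 : p = 2
  · subst hp2
    have h := (Quadratic.ncard_primesOver_two_eq_two_iff h2).mpr (by rw [hdisc]; exact hD8)
    simpa using h
  · haveI : Fact p.Prime := ⟨hp⟩
    refine (Quadratic.ncard_primesOver_eq_two_iff_legendreSym h2 hp2).mpr ?_
    rw [hdisc]
    exact Quadratic.legendreSym_eq_one_of_cast_eq_one (hres p hp hpN hp2)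

/-- `D % 8 = 1` for `D = -q u` with `q ≡ 7 (mod 8)` and `u ≡ 1 (mod 8)`. [folklore] -/
theorem neg_mul_emod_eight {q u : ℤ} (hq : q % 8 = 7) (hu : u ≡ 1 [ZMOD 8]) : (-(q * u)) % 8 = 1 := by
  have h1 : (-q) ≡ 1 [ZMOD 8] := by
    change (-q) % 8 = 1 % 8
    omega
  have h := h1.mul hu
  rw [one_mul, neg_mul] at h
  exact h

/-! ## §4 The starting point: an admissible Heegner twist has odd `2`-Selmer rank -/

/-- **Odd `d₂` for the Heegner twin, modulo Modularity, `2`-parity and Cassels–Tate.** For `W` with `r_an(W) = 0` and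
`ρ̄_{W,2}` onto, `K` imaginary quadratic with the Heegner hypothesis, and any model `Wd ≅ W^{(d_K)}`:
`#Sel₂(Wd) = 2^{2k+1}` for some `k`. Chain: `w(Wd) = −1` (`rootNumber_twin_eq_neg_one`, from `exists_isNewformOf`);
`corank_{ℤ₂} Sel_{2^∞}(Wd)` odd (`p_parity`); `Wd(ℚ)[2] = 0`; `dim Sel₂ = dim Wd(ℚ)[2] + corank + 2m` (Cassels–Tate on
`Ш[2^∞]/div`, tree `exists_selmerRank_eq_add`). [cite: DokchitserDokchitserAnnals2010, Thm. 1.4]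
[cite: Dokchitser2013ParityNotes, §2] -/
theorem exists_card_selmerGroup_twin_eq_two_pow_odd (hmod : exists_isNewformOf)
    (hpar : ∀ V : WeierstrassCurve ℚ, p_parity V 2) (hCT : exists_casselsTate_pairing (K := ℚ))
    (W : WeierstrassCurve ℚ) [W.IsElliptic] (hr0 : W.analyticRank = 0)
    (hsurj : W.HasSurjectiveModNGaloisRep ((2 : ℤ) ^ 1))
    (K : Type) [Field K] [NumberField K] (hK : IsImaginaryQuadratic K)
    (hH : SatisfiesHeegnerHypothesis (W.conductorNorm ℤ) K)
    (Wd : WeierstrassCurve ℚ) [Wd.IsElliptic]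
    (hWd : ∃ C : VariableChange ℚ, C • W.quadraticTwist (NumberField.discr K : ℚ) = Wd) :
    ∃ k : ℕ, Nat.card (Wd.selmerGroup 2) = 2 ^ (2 * k + 1) := by
  haveI : Fact (Nat.Prime 2) := ⟨Nat.prime_two⟩
  have hd : (NumberField.discr K : ℚ) ≠ 0 := by exact_mod_cast NumberField.discr_ne_zero K
  have htors := natCard_twoTorsion_twin_eq_one W hsurj hd Wd hWd
  have hw := rootNumber_twin_eq_neg_one hmod W hr0 K hK hH Wd hWd
  have hodd := odd_selmerCorank_two_of_p_parity Wd (hpar Wd) hw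
  obtain ⟨s, hs⟩ := exists_natCard_selmerGroup_eq_pow Wd 2
  obtain ⟨m, hm⟩ := exists_selmerRank_eq_add hCT Wd 2 s 0 hs (by rw [pow_zero]; convert htors)
  obtain ⟨j, hj⟩ := hodd
  refine ⟨j + m, ?_⟩
  rw [Nat.cast_ofNat] at hs
  rw [hs]
  congr 1
  omega

/-! ## §5 (SUPPLY) from the Mazur–Rubin lowering step, Modularity, `2`-parity and Cassels–Tate -/

/-- **(SUPPLY) ⟸ Mazur–Rubin lowering + Modularity + `2`-parity + Cassels–Tate.** For `W` globally minimal, non-CM,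
`r_an(W) = 0`, `ρ_{W,2^n}` onto for all `n ≥ 1`: there are a Kolyvagin-(H2)-admissible Heegner field `K` (imaginary
quadratic, `d_K` odd, `d_K ≠ −3`, every `q ∣ N_W` split, `d_K·(−|Δ|)` and `d_K·(−2|Δ|)` non-squares) and a globally minimal
`Wd ≅ W^{(d_K)}` with `#Sel₂(Wd) = 2` — the hypothesis `hsupply` of `stub_minimalTwinSupplyAtTwo_of_twoConverse`, VERBATIM.
Construction: Dirichlet gives a prime `q₀ ≡ 7 (mod 8)`, `q₀ ≡ −1 (mod q)` for `q ∣ N_W`, `q₀ > |Δ|`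
(`exists_prime_and_field_discr_eq_neg`); `K₀ = ℚ(√−q₀)` is Heegner, so a minimal model `W₀` of `W^{(−q₀)}` has
`#Sel₂ = 2^{2k+1}` (§4); the walk (§2) with modulus `m = 8 q₀ N_W` gives a square-free `u ≡ 1 (mod m)` and a minimal
`Wd ≅ W^{(−q₀ u)}` with `#Sel₂(Wd) = 2`; `d = −q₀ u ≡ 1 (mod 8)` is a fundamental discriminant, `K = ℚ(√d)`
(`exists_numberField_discr_eq`) is imaginary quadratic with `d_K = d` odd `≤ −7`, Heegner (§3: `d ≡ 1 (mod 8)` and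
`d ≡ (−q₀)·u ≡ 1 (mod q)` for odd `q ∣ N_W`), and `ord_{q₀}(d·|Δ|) = ord_{q₀}(2d·|Δ|) = 1` is odd. The hypotheses `¬CM`
and surjectivity beyond level `2` are idle. [cite: MazurRubin2010, Prop. 5.2 (proof) with Lemma 3.6]
[cite: DokchitserDokchitserAnnals2010, Thm. 1.4] [cite: GrossLMS1991, §1 (p. 235)] -/
theorem minimalSelmerTwinSupply_of_lowering (hmod : exists_isNewformOf)
    (hpar : ∀ V : WeierstrassCurve ℚ, p_parity V 2) (hCT : exists_casselsTate_pairing (K := ℚ))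
    (hMR : ∀ (V : WeierstrassCurve ℚ) [V.IsElliptic], Nat.card (V.toAffine.Point[((2 : ℕ) : ℤ)]) = 1 →
      ∀ s : ℕ, Nat.card (V.selmerGroup 2) = 2 ^ s → 1 < s → ∀ m : ℕ, m ≠ 0 →
        ∃ p : ℕ, p.Prime ∧ (p : ℤ) ≡ 1 [ZMOD (m : ℤ)] ∧
          Nat.card ((V.quadraticTwist (p : ℚ)).selmerGroup 2) = 2 ^ (s - 2)) :
    ∀ (W : WeierstrassCurve ℚ) [W.IsElliptic] [W.IsGloballyMinimal] [NeZero (W.conductorNorm ℤ)],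
      ¬ W.HasCM → W.analyticRank = 0 → (∀ n : ℕ, 0 < n → W.HasSurjectiveModNGaloisRep ((2 : ℤ) ^ n)) →
      ∃ (K : Type) (_ : Field K) (_ : NumberField K),
        IsImaginaryQuadratic K ∧ Odd (NumberField.discr K) ∧ NumberField.discr K ≠ -3 ∧
        SatisfiesHeegnerHypothesis (W.conductorNorm ℤ) K ∧
        ¬ IsSquare ((NumberField.discr K : ℚ) * -|W.Δ|) ∧ ¬ IsSquare ((NumberField.discr K : ℚ) * (-(2 * |W.Δ|))) ∧
        ∃ (Wd : WeierstrassCurve ℚ) (_ : Wd.IsElliptic) (_ : Wd.IsGloballyMinimal),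
          (∃ C : WeierstrassCurve.VariableChange ℚ, C • W.quadraticTwist (NumberField.discr K : ℚ) = Wd) ∧
          Nat.card (Wd.selmerGroup 2) = 2 := by
  intro W _ _ _ _hcm hr0 hρ
  have hN0 : (W.conductorNorm ℤ : ℕ) ≠ 0 := NeZero.ne _
  have hΔ : W.Δ ≠ 0 := W.isUnit_Δ.ne_zero
  -- Step 1: the auxiliary prime `q₀` and `K₀ = ℚ(√-q₀)`
  obtain ⟨q₀, K₀, _, _, hq₀, hq₀n, hq₀8, hq₀mod, h2K₀, hdiscK₀⟩ :=
    Quadratic.exists_prime_and_field_discr_eq_neg (W.conductorNorm ℤ : ℕ).primeFactors (max W.Δ.num.natAbs W.Δ.den)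
  haveI : Fact q₀.Prime := ⟨hq₀⟩
  have hq₀Z : ∀ p : ℕ, p.Prime → p ∣ (W.conductorNorm ℤ : ℕ) → (q₀ : ZMod p) = -1 := fun p hp hpN ↦
    hq₀mod p (Nat.mem_primeFactors.mpr ⟨hp, hpN, hN0⟩) hp.ne_zero
  have hK₀ : IsImaginaryQuadratic K₀ :=
    ⟨h2K₀, Quadratic.isTotallyComplex_of_discr_neg h2K₀ (by rw [hdiscK₀, neg_lt_zero]; exact_mod_cast hq₀.pos)⟩
  have hH₀ : SatisfiesHeegnerHypothesis (W.conductorNorm ℤ) K₀ := by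
    refine satisfiesHeegnerHypothesis_of_discr_congr h2K₀ _ hdiscK₀ (by omega) fun p hp hpN hp2 ↦ ?_
    rw [Int.cast_neg, Int.cast_natCast, hq₀Z p hp hpN, neg_neg]
  -- Step 2: a globally minimal model `W₀` of `W^{(-q₀)}` and its odd `2`-Selmer rank
  have hd₀ : (NumberField.discr K₀ : ℚ) ≠ 0 := by exact_mod_cast NumberField.discr_ne_zero K₀
  haveI := W.isElliptic_quadraticTwist hd₀
  obtain ⟨C₀, hC₀⟩ := hasGlobalMinimalModel_rat_holds (W.quadraticTwist (NumberField.discr K₀ : ℚ))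
  haveI := hC₀
  obtain ⟨k, hk⟩ := exists_card_selmerGroup_twin_eq_two_pow_odd hmod hpar hCT W hr0 (hρ 1 one_pos) K₀ hK₀ hH₀
    (C₀ • W.quadraticTwist (NumberField.discr K₀ : ℚ)) ⟨C₀, rfl⟩
  -- Step 3: the walk, modulus `m = 8 q₀ N`
  have hm : 8 * q₀ * (W.conductorNorm ℤ : ℕ) ≠ 0 := mul_ne_zero (mul_ne_zero (by norm_num) hq₀.ne_zero) hN0
  obtain ⟨u, hu, hum, Wd, _, _, hWd, hSel⟩ := exists_twist_card_selmerGroup_two_of_lowering hMR W (hρ 1 one_pos) k hd₀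
    (C₀ • W.quadraticTwist (NumberField.discr K₀ : ℚ)) ⟨C₀, rfl⟩ hk _ hm
  have hu0 : u ≠ 0 := hu.ne_zero
  have hu8 : (u : ℤ) ≡ 1 [ZMOD 8] := hum.of_dvd ⟨q₀ * (W.conductorNorm ℤ : ℕ), by push_cast; ring⟩
  have huq₀ : (u : ℤ) ≡ 1 [ZMOD q₀] := hum.of_dvd ⟨8 * (W.conductorNorm ℤ : ℕ), by push_cast; ring⟩
  have hq₀u : ¬ q₀ ∣ u := by
    intro h
    have hdu : (q₀ : ℤ) ∣ (u : ℤ) := by exact_mod_cast h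
    have h1 : (q₀ : ℤ) ∣ 1 := by simpa using Int.dvd_sub hdu (Int.ModEq.dvd huq₀.symm)
    exact hq₀.one_lt.ne' (by exact_mod_cast Int.eq_one_of_dvd_one (by positivity) h1)
  -- Step 4: the field `K = ℚ(√(-q₀ u))`
  set D : ℤ := -((q₀ : ℤ) * u) with hDdef
  have hD8 : D % 8 = 1 := neg_mul_emod_eight (by exact_mod_cast hq₀8) hu8
  have hDsq : Squarefree D := by
    rw [hDdef, ← Int.squarefree_natAbs]
    have : ((q₀ : ℤ) * u).natAbs = q₀ * u := by
      rw [Int.natAbs_mul, Int.natAbs_natCast, Int.natAbs_natCast]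
    rw [Int.natAbs_neg, this]
    exact (Nat.squarefree_mul (hq₀.coprime_iff_not_dvd.mpr hq₀u)).mpr ⟨hq₀.squarefree, hu⟩
  have hq₀7 : 7 ≤ q₀ := by omega
  have hDle : D ≤ -7 := by
    have : (7 : ℤ) * 1 ≤ (q₀ : ℤ) * u :=
      mul_le_mul (by exact_mod_cast hq₀7) (by exact_mod_cast Nat.one_le_iff_ne_zero.mpr hu0) zero_le_one
        (by positivity)
    omega
  obtain ⟨K, _, _, h2K, hdiscK⟩ := Quadratic.exists_numberField_discr_eq (D := D) (Or.inl ⟨hD8.symm ▸ by omega, hDsq, by omega⟩)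
  have hdiscKQ : (NumberField.discr K : ℚ) = (NumberField.discr K₀ : ℚ) * u := by
    rw [hdiscK, hdiscK₀, hDdef]; push_cast; ring
  -- `q₀`-adic valuations: `ord_{q₀}(q₀ · u · |Δ|) = 1`, `ord_{q₀}(2) = 0`
  have hq₀Q : (q₀ : ℚ) ≠ 0 := by exact_mod_cast hq₀.ne_zero
  have huQ : (u : ℚ) ≠ 0 := by exact_mod_cast hu0
  have hnum : ¬ (q₀ : ℤ) ∣ W.Δ.num := by
    intro h
    have h' : q₀ ∣ W.Δ.num.natAbs := Int.natCast_dvd.mp h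
    have hpos : 0 < W.Δ.num.natAbs := Int.natAbs_pos.mpr (Rat.num_ne_zero.mpr hΔ)
    have := Nat.le_of_dvd hpos h'
    omega
  have hden : ¬ q₀ ∣ W.Δ.den := by
    intro h
    have := Nat.le_of_dvd W.Δ.den_pos h
    omega
  have hvΔ : padicValRat q₀ W.Δ = 0 := by
    simp only [padicValRat, padicValInt.eq_zero_of_not_dvd hnum, padicValNat.eq_zero_of_not_dvd hden]
    simp
  have hvΔabs : padicValRat q₀ |W.Δ| = 0 := by
    rcases abs_choice W.Δ with h | h
    · rw [h, hvΔ]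
    · rw [h, padicValRat.neg, hvΔ]
  have hvu : padicValRat q₀ (u : ℚ) = 0 := by
    rw [padicValRat.of_nat, padicValNat.eq_zero_of_not_dvd hq₀u, Nat.cast_zero]
  have hv2 : padicValRat q₀ (2 : ℚ) = 0 := by
    have h2 : ¬ q₀ ∣ 2 := fun h ↦ by have := Nat.le_of_dvd two_pos h; omega
    rw [show (2 : ℚ) = ((2 : ℕ) : ℚ) by norm_num, padicValRat.of_nat, padicValNat.eq_zero_of_not_dvd h2,
      Nat.cast_zero]
  have hy0 : (q₀ : ℚ) * u * |W.Δ| ≠ 0 := mul_ne_zero (mul_ne_zero hq₀Q huQ) (abs_ne_zero.mpr hΔ)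
  have hy : padicValRat q₀ ((q₀ : ℚ) * u * |W.Δ|) = 1 := by
    rw [padicValRat.mul (mul_ne_zero hq₀Q huQ) (abs_ne_zero.mpr hΔ), padicValRat.mul hq₀Q huQ,
      padicValRat.self hq₀.one_lt, hvu, hvΔabs]
    simp
  refine ⟨K, inferInstance, inferInstance, ?_, ?_, ?_, ?_, ?_, ?_, Wd, inferInstance, inferInstance, ?_, hSel⟩
  · -- imaginary quadratic
    exact ⟨h2K, Quadratic.isTotallyComplex_of_discr_neg h2K (by rw [hdiscK]; omega)⟩
  · -- `d_K` odd
    rw [hdiscK, Int.odd_iff]; omega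
  · -- `d_K ≠ -3`
    rw [hdiscK]; omega
  · -- Heegner hypothesis
    refine satisfiesHeegnerHypothesis_of_discr_congr h2K _ hdiscK hD8 fun p hp hpN hp2 ↦ ?_
    have hpm : p ∣ 8 * q₀ * (W.conductorNorm ℤ : ℕ) := hpN.mul_left _
    have hup : ((u : ℤ) : ZMod p) = ((1 : ℤ) : ZMod p) := Quadratic.intCast_zmod_eq_of_modEq_of_dvd hum hpm
    rw [hDdef, Int.cast_neg, Int.cast_mul, Int.cast_natCast, hq₀Z p hp hpN, hup]
    push_cast; ring
  · -- `d_K · (−|Δ|)` is not a square: its `q₀`-adic valuation is `1`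
    have hx : (NumberField.discr K : ℚ) * -|W.Δ| = (q₀ : ℚ) * u * |W.Δ| := by rw [hdiscK, hDdef]; push_cast; ring
    rw [hx]
    exact not_isSquare_of_odd_padicValRat (q := q₀) hy0 (by rw [hy]; exact odd_one)
  · -- `d_K · (−2|Δ|)` is not a square: its `q₀`-adic valuation is `1`
    have hx : (NumberField.discr K : ℚ) * (-(2 * |W.Δ|)) = 2 * ((q₀ : ℚ) * u * |W.Δ|) := by
      rw [hdiscK, hDdef]; push_cast; ring
    rw [hx]
    refine not_isSquare_of_odd_padicValRat (q := q₀) (mul_ne_zero two_ne_zero hy0) ?_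
    rw [padicValRat.mul two_ne_zero hy0, hy, hv2, zero_add]
    exact odd_one
  · -- the twin
    rw [hdiscKQ]
    exact hWd

/-! ## §6 Stub A modulo Mazur–Rubin, Modularity, `2`-parity, Cassels–Tate and the `2`-converse -/

/-- **STUB A ⟸ (MR lowering) ∧ Modularity ∧ `2`-parity ∧ Cassels–Tate ∧ (CONV₂).** The registered stub
`stub_minimalTwinSupplyAtTwo` of line `genus-supply` (crux 22136) VERBATIM, from: the Mazur–Rubin lowering step `hMR`
(Mazur–Rubin 2010 Prop. 5.2, proof form over `ℚ`; PRINT), Modularity `exists_isNewformOf` (BCDT 2001; PRINT), the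
`2`-parity theorem `p_parity · 2` (Dokchitser–Dokchitser 2010 ∕ Monsky 1996; PRINT), the Cassels–Tate pairing
`exists_casselsTate_pairing` (Cassels 1962; PRINT), and the rank-one `2`-converse `hconv` (OPEN: crux 19220 of route
`TwoAdicConverse`, here without its reduction-type clause). Composition of `minimalSelmerTwinSupply_of_lowering` with the
LEAD's `stub_minimalTwinSupplyAtTwo_of_twoConverse`. So stub A's only non-print input is the `2`-converse. BSD is not
proved by any of this. [cite: MazurRubin2010, Prop. 5.2 (proof) with Lemma 3.6] [cite: DokchitserDokchitserAnnals2010, Thm. 1.4] -/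
theorem stub_minimalTwinSupplyAtTwo_of_lowering_of_twoConverse (hmod : exists_isNewformOf)
    (hpar : ∀ V : WeierstrassCurve ℚ, p_parity V 2) (hCT : exists_casselsTate_pairing (K := ℚ))
    (hMR : ∀ (V : WeierstrassCurve ℚ) [V.IsElliptic], Nat.card (V.toAffine.Point[((2 : ℕ) : ℤ)]) = 1 →
      ∀ s : ℕ, Nat.card (V.selmerGroup 2) = 2 ^ s → 1 < s → ∀ m : ℕ, m ≠ 0 →
        ∃ p : ℕ, p.Prime ∧ (p : ℤ) ≡ 1 [ZMOD (m : ℤ)] ∧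
          Nat.card ((V.quadraticTwist (p : ℚ)).selmerGroup 2) = 2 ^ (s - 2))
    (hconv : ∀ (V : WeierstrassCurve ℚ) [V.IsElliptic] [V.IsGloballyMinimal],
      ¬ V.HasCM → V.selmerCorank 2 = 1 → V.analyticRank = 1) :
    ∀ (W : WeierstrassCurve ℚ) [W.IsElliptic] [W.IsGloballyMinimal] [NeZero (W.conductorNorm ℤ)],
      ¬ W.HasCM → W.analyticRank = 0 → (∀ n : ℕ, 0 < n → W.HasSurjectiveModNGaloisRep ((2 : ℤ) ^ n)) →
      ∃ (K : Type) (_ : Field K) (_ : NumberField K),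
        IsImaginaryQuadratic K ∧ Odd (NumberField.discr K) ∧ NumberField.discr K ≠ -3 ∧
        SatisfiesHeegnerHypothesis (W.conductorNorm ℤ) K ∧
        ¬ IsSquare ((NumberField.discr K : ℚ) * -|W.Δ|) ∧ ¬ IsSquare ((NumberField.discr K : ℚ) * (-(2 * |W.Δ|))) ∧
        ∃ (Wd : WeierstrassCurve ℚ) (_ : Wd.IsElliptic) (_ : Wd.IsGloballyMinimal),
          (∃ C : WeierstrassCurve.VariableChange ℚ, C • W.quadraticTwist (NumberField.discr K : ℚ) = Wd) ∧
          Wd.analyticRank = 1 ∧ Nat.card (Wd.selmerGroup 2) = 2 :=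
  stub_minimalTwinSupplyAtTwo_of_twoConverse hmod hpar hconv (minimalSelmerTwinSupply_of_lowering hmod hpar hCT hMR)

end Summit.BirchSwinnertonDyer.BirchSwinnertonDyer.Theorems.GenusKoly

end
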